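import Summits.Ventures.CertifiedManyBodySolver.Rows.HalfFilledTLTorusPin
import Summits.Ventures.CertifiedManyBodySolver.Rows.HalfFilledTLTorusStag
import Literature.MathematicalPhysics.QuantumLattice.HubbardPairDensityCouplingFloor

/-!
# M2 rows, part 8: correlator rows of THE ground state from a pinned-block eigenvector enclosure

HONEST FRAMING (speedrun cell `mbsolver`, M2): first certified bounds; not a superconductivity
verdict; every number certified or labelled float.  This file contains NO numbers.  Part 7
(`HalfFilledTLTorusPin`) typed the ENERGY half of a Kato–Temple enclosure compressed to a symmetry block
`K` of the `L × L` half-filled torus; this part types the CORRELATOR half (the table's enclosure records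
for `D`, `C₁ = ⟨S·S⟩_NN`, `S(π,π)`, `m_s²`): in a PINNED block (`M2.TorusBlockPinRow L U K`) on an even
torus with `U > 0`,

* THE ground state lies in the block (`TorusBlockPinRow.groundState_mem`: the block minimum is attained
  at an `L²`-particle eigenvector with eigenvalue `E₀`, which by Lieb's uniqueness spans the ground
  states);
* the Kato–Temple EIGENVECTOR bound of the block certificate (`TempleKato.sector_enclosure_of_sums`:
  `(N − |⟨ψ_K, w⟩|²)(σ − ρ)² ≤ r² N` for the block's simple unit ground state `ψ_K` and the integer trial
  vector `w`, `⟨w, w⟩ = N`) transfers to EVERY normalised ground state `ψ` (a phase times `ψ_K`), and the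
  mixing estimate `TempleKato.abs_expect_sub_expect_le` then encloses `Re⟨ψ, O ψ⟩` around the exact
  rational trial value `⟨w, O w⟩/N` with radius `2h(β + β²)` for any observable with form bound
  `|⟨x, (O − m)x⟩| ≤ h‖x‖²` and any `β ≥ 0` with `r² ≤ β²(σ − ρ)²`
  (`TorusBlockPinRow.abs_re_expect_sub_le`);
* hence the finite-torus rows of parts 1/5/6 — `TorusDoccRow`, `TorusSpinNNRow`, `TorusStagSFRow`,
  `StagMagSqRow`, all of shape `lo ≤ Re⟨ψ, O ψ⟩/L^k ≤ hi` on normalised ground states — follow from the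
  rational comparisons `lo·L^k ≤ ⟨w,Ow⟩/N − 2h(β+β²)` and `⟨w,Ow⟩/N + 2h(β+β²) ≤ hi·L^k`
  (`….of_blockPin_templeKato`).

Hypotheses by name = the certificate's claim nodes: pin (part 7: `of_exclusion` at one `U₀` +
`propagate`), block invariance, form floor `σ` on `W` with `K ≤ W + ℂu` (PD gap + frames/completeness),
exact sums `N, ρN, (r²+ρ²)N, oN` of `w ∈ K` (Rayleigh data), the observable's range node `(m, h)`, and
`β`.  Lieb's theorem and Kato–Temple are tree theorems; for `D` the range node is a tree theorem too
(§4, `docc_formBound`: `0 ≤ D ≤ L²` as forms, so `(m, h) = (L²/2, L²/2)` and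
`TorusDoccRow.of_blockPin_templeKato_range` carries no `hOform`).
References: Lieb, PRL 62 (1989) 1201, Thm 2; Saad (1992) Ch. III §3.2 Thm 3.8–3.9; Tasaki (2020) §2.1;
Hirsch, PRB 31 (1985) 4403, §III.
-/

noncomputable section

namespace Summit.Ventures.CertifiedManyBodySolver
open Literature.MathematicalPhysics.QuantumLattice
open Matrix HubbardWave0 Literature.Probability.LatticeModels EigenvalueContinuation FermionSpinMoment
open scoped ComplexOrder

namespace M2

variable {L : ℕ}

/-! ## §1 THE ground state lies in a pinned block -/

/-- **A pinned block contains the ground state** (even torus, `U > 0`): if `K ≠ ⊥` is an `H`-invariant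
block of `L²`-particle states with `minEnergyOn (H U) K = E₀(L²)`, then every `L²`-particle ground
state lies in `K` — the block minimum is attained at an eigenvector with eigenvalue `E₀`, i.e. at a
ground state, and the ground state is simple (Lieb). [cite: LiebPRL1989, Theorem 2] -/
theorem TorusBlockPinRow.groundState_mem [NeZero L] (hL : Even L) {U : ℝ} (hU : 0 < U)
    {K : Submodule ℂ (Fock (Orb (FermionTorus 2 L)))} (hKN : K ≤ nParticleSubmodule (L ^ 2))
    (hKH : ∀ v ∈ K, hamiltonian (fermionTorusGraph 2 L) 1 U *ᵥ v ∈ K) (hK : K ≠ ⊥)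
    (hpin : TorusBlockPinRow L U K) {ψ : Fock (Orb (FermionTorus 2 L))}
    (hψ : IsGroundState (hamiltonian (fermionTorusGraph 2 L) 1 U) (L ^ 2) ψ) : ψ ∈ K := by
  obtain ⟨φ, hφK, hφ1, hHφ⟩ :=
    exists_unit_eigen_minEnergyOn (LiebThm1.hamiltonian_isHermitian (fermionTorusGraph 2 L) 1 U) K hKH hK
  unfold TorusBlockPinRow at hpin
  rw [hpin] at hHφ
  obtain ⟨ψL, -, -, -, huniq, -⟩ :=
    LiebHalfFilled.hubbardTorus_exists_unit_groundState_pow (d := 2) (L := L) two_pos hL one_ne_zero hU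
  have hφN : IsNParticle (L ^ 2) φ := (mem_nParticleSubmodule_iff _ φ).1 (hKN hφK)
  have eφ := huniq φ hφN hHφ
  obtain ⟨hψN, -, hHψ⟩ := hψ
  have eψ := huniq ψ hψN hHψ
  have hc0 : star ψL ⬝ᵥ φ ≠ 0 := by
    intro h0
    rw [h0, zero_smul] at eφ
    rw [eφ, star_zero, zero_dotProduct] at hφ1
    exact zero_ne_one hφ1
  have hψL : ψL ∈ K := by
    have : ψL = (star ψL ⬝ᵥ φ)⁻¹ • φ := by
      rw [eq_inv_smul_iff₀ hc0]; exact eφ.symm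
    rw [this]; exact K.smul_mem _ hφK
  rw [eψ]; exact K.smul_mem _ hψL

/-! ## §2 The eigenvector enclosure transfers to every normalised ground state -/

/-- A unit multiple of a unit vector has a unit scalar: `‖c‖² = 1`. [folklore] -/
theorem norm_sq_eq_one_of_unit_smul {ι : Type*} [Fintype ι] {φ : ι → ℂ} {c : ℂ}
    (hφ1 : star φ ⬝ᵥ φ = 1) (h1 : star (c • φ) ⬝ᵥ (c • φ) = 1) : ‖c‖ ^ 2 = 1 := by
  rw [star_smul, smul_dotProduct, dotProduct_smul, hφ1, smul_eq_mul, smul_eq_mul, mul_one,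
    Complex.star_def, ← Complex.normSq_eq_conj_mul_self, Complex.normSq_eq_norm_sq] at h1
  exact_mod_cast h1

/-- **Observable enclosure for THE ground state from a pinned-block Kato–Temple certificate.**  On an
even torus with `U > 0`, let `K` be a pinned `H`-invariant block of `L²`-particle states carrying the
data of `TempleKato.sector_enclosure_of_sums` (form floor `σ` on `W`, `K ≤ W + ℂu`, `w ∈ K` with exact
sums `⟨w,w⟩ = N > 0`, `⟨w,Hw⟩ = ρN`, `⟨Hw,Hw⟩ ≤ (r²+ρ²)N`, `ρ < σ`), an observable `O` with form bound
`|⟨x,(O − m)x⟩| ≤ h‖x‖²` and exact trial sum `Re⟨w,Ow⟩ = oN`, and `β ≥ 0` with `r² ≤ β²(σ−ρ)²`.  Then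
every normalised `L²`-particle ground state `ψ` satisfies `|Re⟨ψ,Oψ⟩ − o| ≤ 2h(β + β²)`.
[cite: Saad1992, Ch. III §3.2 Thm 3.8–3.9] [cite: LiebPRL1989, Theorem 2] -/
theorem TorusBlockPinRow.abs_re_expect_sub_le [NeZero L] (hL : Even L) {U : ℝ} (hU : 0 < U)
    {K : Submodule ℂ (Fock (Orb (FermionTorus 2 L)))} (hKN : K ≤ nParticleSubmodule (L ^ 2))
    (hKH : ∀ v ∈ K, hamiltonian (fermionTorusGraph 2 L) 1 U *ᵥ v ∈ K) (hpin : TorusBlockPinRow L U K)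
    {W : Submodule ℂ (Fock (Orb (FermionTorus 2 L)))} {u : Fock (Orb (FermionTorus 2 L))} {σ : ℝ}
    (hW : ∀ z ∈ W, σ * (star z ⬝ᵥ z).re ≤ (star z ⬝ᵥ hamiltonian (fermionTorusGraph 2 L) 1 U *ᵥ z).re)
    (hWK : ∀ x ∈ K, ∃ z ∈ W, ∃ c : ℂ, x = z + c • u)
    {w : Fock (Orb (FermionTorus 2 L))} (hwK : w ∈ K) {N ρ r2 : ℝ} (hN : 0 < N)
    (hwN : (star w ⬝ᵥ w).re = N)
    (hρ : (star w ⬝ᵥ hamiltonian (fermionTorusGraph 2 L) 1 U *ᵥ w).re = ρ * N)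
    (hr2 : (star (hamiltonian (fermionTorusGraph 2 L) 1 U *ᵥ w) ⬝ᵥ
      hamiltonian (fermionTorusGraph 2 L) 1 U *ᵥ w).re ≤ (r2 + ρ ^ 2) * N)
    (hρσ : ρ < σ) {O : Matrix (Finset (Orb (FermionTorus 2 L))) (Finset (Orb (FermionTorus 2 L))) ℂ}
    {m h β o : ℝ}
    (hOform : ∀ x, ‖star x ⬝ᵥ O *ᵥ x - (m : ℂ) * (star x ⬝ᵥ x)‖ ≤ h * (star x ⬝ᵥ x).re)
    (ho : (star w ⬝ᵥ O *ᵥ w).re = o * N) (hβ : 0 ≤ β) (hβr : r2 ≤ β ^ 2 * (σ - ρ) ^ 2) :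
    ∀ ψ : Fock (Orb (FermionTorus 2 L)),
      IsGroundState (hamiltonian (fermionTorusGraph 2 L) 1 U) (L ^ 2) ψ → star ψ ⬝ᵥ ψ = 1 →
        |(star ψ ⬝ᵥ O *ᵥ ψ).re - o| ≤ 2 * h * (β + β ^ 2) := by
  intro ψ hψ hψ1
  set H := hamiltonian (fermionTorusGraph 2 L) 1 U with hH
  have hHerm : H.IsHermitian := LiebThm1.hamiltonian_isHermitian (fermionTorusGraph 2 L) 1 U
  -- the block certificate: simple unit block ground state `ψK` and its eigenvector bound
  obtain ⟨-, -, ψK, hψKK, hψK1, hHψK, huniqK, -, hsin⟩ :=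
    TempleKato.sector_enclosure_of_sums hHerm K hKH hW hWK hwK hN hwN hρ hr2 hρσ
  have hw0 : w ≠ 0 := by
    rintro rfl
    rw [dotProduct_zero, Complex.zero_re] at hwN
    exact hN.ne' hwN.symm
  have hK : K ≠ ⊥ := fun hb => hw0 ((Submodule.mem_bot ℂ).1 (hb ▸ hwK))
  -- THE ground state lies in `K` and is a phase times `ψK`
  have hψK : ψ ∈ K := TorusBlockPinRow.groundState_mem hL hU hKN hKH hK hpin hψ
  obtain ⟨-, -, hHψ⟩ := hψ
  have hpin' : groundEnergy H (L ^ 2) = H.minEnergyOn K := hpin.symm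
  rw [hpin'] at hHψ
  have eψ : ψ = (star ψK ⬝ᵥ ψ) • ψK := huniqK ψ hψK hHψ
  set c : ℂ := star ψK ⬝ᵥ ψ with hc
  have hc1 : ‖c‖ ^ 2 = 1 := norm_sq_eq_one_of_unit_smul hψK1 (eψ ▸ hψ1)
  -- normalise the trial vector: `w' = a • w`, `a² N = 1`
  obtain ⟨a, ha, haa, ha1⟩ := exists_normalize hw0
  rw [hwN] at haa
  set w' : Fock (Orb (FermionTorus 2 L)) := (a : ℂ) • w with hw'
  -- overlap of `w'` with `ψ`: `‖⟨w', ψ⟩‖² = a² ‖⟨ψK, w⟩‖²`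
  have hov : ‖star w' ⬝ᵥ ψ‖ ^ 2 = a * a * ‖star ψK ⬝ᵥ w‖ ^ 2 := by
    have h1 : star w' ⬝ᵥ ψ = star ((a : ℂ)) * c * star (star ψK ⬝ᵥ w) := by
      rw [hw', eψ, star_smul, smul_dotProduct, dotProduct_smul, smul_eq_mul, smul_eq_mul,
        ← star_dotProduct_star, star_star]
      ring
    rw [h1, norm_mul, norm_mul, norm_star, norm_star, Complex.norm_real, Real.norm_of_nonneg ha.le,
      mul_pow, mul_pow, hc1, mul_one, sq a]
  have hover : 1 - ‖star w' ⬝ᵥ ψ‖ ^ 2 ≤ β ^ 2 := by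
    rw [hov]
    have hs : 0 < (σ - ρ) ^ 2 := by have := sub_pos.2 hρσ; positivity
    have key : (1 - a * a * ‖star ψK ⬝ᵥ w‖ ^ 2) * (σ - ρ) ^ 2 ≤ β ^ 2 * (σ - ρ) ^ 2 := by
      have e1 : (1 - a * a * ‖star ψK ⬝ᵥ w‖ ^ 2) * (σ - ρ) ^ 2 =
          a * a * ((N - ‖star ψK ⬝ᵥ w‖ ^ 2) * (σ - ρ) ^ 2) := by
        have : a * a * N = 1 := haa
        calc (1 - a * a * ‖star ψK ⬝ᵥ w‖ ^ 2) * (σ - ρ) ^ 2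
            = (a * a * N - a * a * ‖star ψK ⬝ᵥ w‖ ^ 2) * (σ - ρ) ^ 2 := by rw [this]
          _ = a * a * ((N - ‖star ψK ⬝ᵥ w‖ ^ 2) * (σ - ρ) ^ 2) := by ring
      rw [e1]
      calc a * a * ((N - ‖star ψK ⬝ᵥ w‖ ^ 2) * (σ - ρ) ^ 2) ≤ a * a * (r2 * N) :=
            mul_le_mul_of_nonneg_left hsin (mul_self_nonneg a)
        _ = r2 := by rw [mul_comm r2 N, ← mul_assoc, haa, one_mul]
        _ ≤ β ^ 2 * (σ - ρ) ^ 2 := hβr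
    exact le_of_mul_le_mul_right key hs
  have hw'1 : star w' ⬝ᵥ w' = 1 := ha1
  -- the trial value in `w'` is `o`
  have ho' : (star w' ⬝ᵥ O *ᵥ w').re = o := by
    rw [hw', mulVec_smul, star_real_smul_dotProduct_real_smul, Complex.re_ofReal_mul, ho, ← mul_assoc,
      mul_comm (a * a), mul_assoc, haa, mul_one]
  have hmain := TempleKato.abs_expect_sub_expect_le hOform hψ1 hw'1 hβ hover
  rw [ho'] at hmain
  exact hmain

/-! ## §3 The finite-torus rows of parts 1/5/6 from a pinned-block certificate -/

/-- **Row reading of an observable enclosure**: a quantity `f ψ = Re⟨ψ,Oψ⟩/D` (`D > 0`) of normalised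
ground states enclosed by `|Re⟨ψ,Oψ⟩ − o| ≤ ε` lies in `[lo, hi]` as soon as `lo·D ≤ o − ε` and
`o + ε ≤ hi·D` (rational comparisons). [folklore] -/
theorem groundStateRow_of_enclosure {U : ℝ}
    {O : Matrix (Finset (Orb (FermionTorus 2 L))) (Finset (Orb (FermionTorus 2 L))) ℂ} {o ε : ℝ}
    (henc : ∀ ψ : Fock (Orb (FermionTorus 2 L)),
      IsGroundState (hamiltonian (fermionTorusGraph 2 L) 1 U) (L ^ 2) ψ → star ψ ⬝ᵥ ψ = 1 →
        |(star ψ ⬝ᵥ O *ᵥ ψ).re - o| ≤ ε)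
    {D : ℝ} (hD : 0 < D) {lo hi : ℚ} (hlo : ((lo : ℚ) : ℝ) * D ≤ o - ε) (hhi : o + ε ≤ ((hi : ℚ) : ℝ) * D) :
    ∀ ψ : Fock (Orb (FermionTorus 2 L)),
      IsGroundState (hamiltonian (fermionTorusGraph 2 L) 1 U) (L ^ 2) ψ → star ψ ⬝ᵥ ψ = 1 →
        ((lo : ℚ) : ℝ) ≤ (star ψ ⬝ᵥ O *ᵥ ψ).re / D ∧ (star ψ ⬝ᵥ O *ᵥ ψ).re / D ≤ ((hi : ℚ) : ℝ) := by
  intro ψ hψ h1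
  have h := abs_le.1 (henc ψ hψ h1)
  rw [le_div_iff₀ hD, div_le_iff₀ hD]
  constructor <;> linarith [h.1, h.2]


/-! ## §4 The observable-range node, discharged in the tree for `D`

A form bound `‖⟨x,Ox⟩ − c‖x‖²‖ ≤ c‖x‖²` follows from `0 ≤ O ≤ 2c` as forms; for the double occupancy
`D = Σ_x n_{x↑}n_{x↓}` the tree has `0 ≤ D ≤ L²` (`posSemidef_sum_numberOp_mul_numberOp`,
`re_expect_interaction_torus_mem_Icc`), so the range node of §2 HOLDS for `D` with
`(m, h) = (L²/2, L²/2)` and the docc edge needs no `hOform` hypothesis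
(`TorusDoccRow.of_blockPin_templeKato_range`, §3). The spin observables keep the hypothesis. -/

/-- `‖⟨x,Ox⟩ − c⟨x,x⟩‖ ≤ c·Re⟨x,x⟩` whenever `⟨x,Ox⟩` is real with `0 ≤ Re⟨x,Ox⟩ ≤ 2c·Re⟨x,x⟩`. [folklore] -/
theorem formBound_of_re_mem {ι : Type*} [Fintype ι] {O : Matrix ι ι ℂ} {c : ℝ} {x : ι → ℂ}
    (him : (star x ⬝ᵥ O *ᵥ x).im = 0) (h0 : 0 ≤ (star x ⬝ᵥ O *ᵥ x).re)
    (h1 : (star x ⬝ᵥ O *ᵥ x).re ≤ 2 * c * (star x ⬝ᵥ x).re) :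
    ‖star x ⬝ᵥ O *ᵥ x - (c : ℂ) * (star x ⬝ᵥ x)‖ ≤ c * (star x ⬝ᵥ x).re := by
  have hn := Complex.nonneg_iff.1 (dotProduct_star_self_nonneg x)
  have hnim : (star x ⬝ᵥ x).im = 0 := hn.2.symm
  have hz : star x ⬝ᵥ O *ᵥ x - (c : ℂ) * (star x ⬝ᵥ x) =
      (((star x ⬝ᵥ O *ᵥ x).re - c * (star x ⬝ᵥ x).re : ℝ) : ℂ) := by
    apply Complex.ext
    · simp [Complex.sub_re, Complex.mul_re, hnim]
    · simp [Complex.sub_im, Complex.mul_im, him, hnim]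
  rw [hz, Complex.norm_real, Real.norm_eq_abs]
  exact abs_le.2 ⟨by nlinarith [hn.1], by nlinarith [hn.1]⟩

/-- **Range node for `D` (tree theorem)**: `‖⟨x,Dx⟩ − (L²/2)⟨x,x⟩‖ ≤ (L²/2)·Re⟨x,x⟩` on the torus of
side `L`, from `0 ≤ D ≤ L²` as forms. [folklore] -/
theorem docc_formBound (x : Fock (Orb (FermionTorus 2 L))) :
    ‖star x ⬝ᵥ (∑ y : FermionTorus 2 L, numberOp y 0 * numberOp y 1) *ᵥ x -
        (((L : ℝ) ^ 2 / 2 : ℝ) : ℂ) * (star x ⬝ᵥ x)‖ ≤ (L : ℝ) ^ 2 / 2 * (star x ⬝ᵥ x).re := by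
  have h0 := Complex.nonneg_iff.1
    ((posSemidef_sum_numberOp_mul_numberOp (Λ := FermionTorus 2 L)).dotProduct_mulVec_nonneg x)
  have h1 := (re_expect_interaction_torus_mem_Icc x).2
  exact formBound_of_re_mem h0.2.symm h0.1 (by linarith)

section Rows

variable [NeZero L] (hL : Even L) {U : ℝ} (hU : 0 < U)
  {K : Submodule ℂ (Fock (Orb (FermionTorus 2 L)))} (hKN : K ≤ nParticleSubmodule (L ^ 2))
  (hKH : ∀ v ∈ K, hamiltonian (fermionTorusGraph 2 L) 1 U *ᵥ v ∈ K) (hpin : TorusBlockPinRow L U K)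
  {W : Submodule ℂ (Fock (Orb (FermionTorus 2 L)))} {u : Fock (Orb (FermionTorus 2 L))} {σ : ℝ}
  (hW : ∀ z ∈ W, σ * (star z ⬝ᵥ z).re ≤ (star z ⬝ᵥ hamiltonian (fermionTorusGraph 2 L) 1 U *ᵥ z).re)
  (hWK : ∀ x ∈ K, ∃ z ∈ W, ∃ c : ℂ, x = z + c • u)
  {w : Fock (Orb (FermionTorus 2 L))} (hwK : w ∈ K) {N ρ r2 : ℝ} (hN : 0 < N)
  (hwN : (star w ⬝ᵥ w).re = N)
  (hρ : (star w ⬝ᵥ hamiltonian (fermionTorusGraph 2 L) 1 U *ᵥ w).re = ρ * N)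
  (hr2 : (star (hamiltonian (fermionTorusGraph 2 L) 1 U *ᵥ w) ⬝ᵥ
    hamiltonian (fermionTorusGraph 2 L) 1 U *ᵥ w).re ≤ (r2 + ρ ^ 2) * N)
  (hρσ : ρ < σ) {m h β o : ℝ} (hβ : 0 ≤ β) (hβr : r2 ≤ β ^ 2 * (σ - ρ) ^ 2)
include hL hU hKN hKH hpin hW hWK hwK hN hwN hρ hr2 hρσ hβ hβr

/-- **`T{L}_D` from a pinned-block certificate**: docc density `d_L(ψ) = Re⟨ψ, Dψ⟩/L²`,
`D = Σ_x n_{x↑} n_{x↓}`, with range node `(m, h)` and trial sum `Re⟨w, Dw⟩ = oN`.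
[cite: KomaTasaki1994, §1] [cite: Saad1992, Ch. III §3.2 Thm 3.8–3.9] -/
theorem TorusDoccRow.of_blockPin_templeKato
    (hOform : ∀ x, ‖star x ⬝ᵥ (∑ y : FermionTorus 2 L, numberOp y 0 * numberOp y 1) *ᵥ x -
      (m : ℂ) * (star x ⬝ᵥ x)‖ ≤ h * (star x ⬝ᵥ x).re)
    (ho : (star w ⬝ᵥ (∑ y : FermionTorus 2 L, numberOp y 0 * numberOp y 1) *ᵥ w).re = o * N)
    {lo hi : ℚ} (hlo : ((lo : ℚ) : ℝ) * (L : ℝ) ^ 2 ≤ o - 2 * h * (β + β ^ 2))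
    (hhi : o + 2 * h * (β + β ^ 2) ≤ ((hi : ℚ) : ℝ) * (L : ℝ) ^ 2) : TorusDoccRow L U lo hi :=
  groundStateRow_of_enclosure
    (TorusBlockPinRow.abs_re_expect_sub_le hL hU hKN hKH hpin hW hWK hwK hN hwN hρ hr2 hρσ hOform ho hβ hβr)
    (by have := NeZero.pos L; positivity) hlo hhi

/-- **`T{L}_D` from a pinned-block certificate, range node discharged** (`docc_formBound`:
`(m, h) = (L²/2, L²/2)`): the Temple–Kato mixing radius is `L²(β + β²)`.
[cite: KomaTasaki1994, §1] [cite: Saad1992, Ch. III §3.2 Thm 3.8–3.9] -/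
theorem TorusDoccRow.of_blockPin_templeKato_range
    (ho : (star w ⬝ᵥ (∑ y : FermionTorus 2 L, numberOp y 0 * numberOp y 1) *ᵥ w).re = o * N)
    {lo hi : ℚ} (hlo : ((lo : ℚ) : ℝ) * (L : ℝ) ^ 2 ≤ o - (L : ℝ) ^ 2 * (β + β ^ 2))
    (hhi : o + (L : ℝ) ^ 2 * (β + β ^ 2) ≤ ((hi : ℚ) : ℝ) * (L : ℝ) ^ 2) : TorusDoccRow L U lo hi :=
  TorusDoccRow.of_blockPin_templeKato hL hU hKN hKH hpin hW hWK hwK hN hwN hρ hr2 hρσ hβ hβr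
    docc_formBound ho
    (by have : 2 * ((L : ℝ) ^ 2 / 2) * (β + β ^ 2) = (L : ℝ) ^ 2 * (β + β ^ 2) := by ring
        linarith)
    (by have : 2 * ((L : ℝ) ^ 2 / 2) * (β + β ^ 2) = (L : ℝ) ^ 2 * (β + β ^ 2) := by ring
        linarith)

/-- **`T{L}_C1` from a pinned-block certificate**: `L⁻² Re⟨ψ, W_{e₁}ψ⟩`, `W_{e₁} = Σ_u 𝐒_u·𝐒_{u+e₁}`
(`Observables.spinCorrSum L e₁`), range node `(m, h)`, trial sum `Re⟨w, W_{e₁} w⟩ = oN`.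
[cite: Hirsch1985, §III] [cite: Saad1992, Ch. III §3.2 Thm 3.8–3.9] -/
theorem TorusSpinNNRow.of_blockPin_templeKato
    (hOform : ∀ x, ‖star x ⬝ᵥ Observables.spinCorrSum L (Pi.single 0 1) *ᵥ x - (m : ℂ) * (star x ⬝ᵥ x)‖ ≤
      h * (star x ⬝ᵥ x).re)
    (ho : (star w ⬝ᵥ Observables.spinCorrSum L (Pi.single 0 1) *ᵥ w).re = o * N)
    {lo hi : ℚ} (hlo : ((lo : ℚ) : ℝ) * (L : ℝ) ^ 2 ≤ o - 2 * h * (β + β ^ 2))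
    (hhi : o + 2 * h * (β + β ^ 2) ≤ ((hi : ℚ) : ℝ) * (L : ℝ) ^ 2) : TorusSpinNNRow L U lo hi :=
  groundStateRow_of_enclosure
    (TorusBlockPinRow.abs_re_expect_sub_le hL hU hKN hKH hpin hW hWK hwK hN hwN hρ hr2 hρσ hOform ho hβ hβr)
    (by have := NeZero.pos L; positivity) hlo hhi

/-- **`T{L}_S` (spin structure factor at `(π,π)`) from a pinned-block certificate**:
`S(π,π; ψ) = Re⟨ψ, 𝓢_s(π,π) ψ⟩/L²` (`Observables.spinStructureOp L (piIndex L)`), range node `(m, h)`,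
trial sum `= oN`. [cite: Hirsch1985, §III] [cite: Saad1992, Ch. III §3.2 Thm 3.8–3.9] -/
theorem TorusStagSFRow.of_blockPin_templeKato
    (hOform : ∀ x, ‖star x ⬝ᵥ Observables.spinStructureOp L (piIndex L) *ᵥ x - (m : ℂ) * (star x ⬝ᵥ x)‖ ≤
      h * (star x ⬝ᵥ x).re)
    (ho : (star w ⬝ᵥ Observables.spinStructureOp L (piIndex L) *ᵥ w).re = o * N)
    {lo hi : ℚ} (hlo : ((lo : ℚ) : ℝ) * (L : ℝ) ^ 2 ≤ o - 2 * h * (β + β ^ 2))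
    (hhi : o + 2 * h * (β + β ^ 2) ≤ ((hi : ℚ) : ℝ) * (L : ℝ) ^ 2) : TorusStagSFRow L U lo hi :=
  groundStateRow_of_enclosure
    (TorusBlockPinRow.abs_re_expect_sub_le hL hU hKN hKH hpin hW hWK hwK hN hwN hρ hr2 hρσ hOform ho hβ hβr)
    (by have := NeZero.pos L; positivity) hlo hhi

/-- **`T{L}_ms2` from a pinned-block certificate**: `m_s²(L; ψ) = Re⟨ψ, 𝓢_A ψ⟩/L⁴`
(`stagSpinStructure (evenSublattice L)`), range node `(m, h)`, trial sum `= oN`.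
[cite: LiebPRL1989, Theorem 2] [cite: Saad1992, Ch. III §3.2 Thm 3.8–3.9] -/
theorem StagMagSqRow.of_blockPin_templeKato
    (hOform : ∀ x, ‖star x ⬝ᵥ stagSpinStructure (evenSublattice L) *ᵥ x - (m : ℂ) * (star x ⬝ᵥ x)‖ ≤
      h * (star x ⬝ᵥ x).re)
    (ho : (star w ⬝ᵥ stagSpinStructure (evenSublattice L) *ᵥ w).re = o * N)
    {lo hi : ℚ} (hlo : ((lo : ℚ) : ℝ) * (L : ℝ) ^ 4 ≤ o - 2 * h * (β + β ^ 2))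
    (hhi : o + 2 * h * (β + β ^ 2) ≤ ((hi : ℚ) : ℝ) * (L : ℝ) ^ 4) : StagMagSqRow L U lo hi :=
  groundStateRow_of_enclosure
    (TorusBlockPinRow.abs_re_expect_sub_le hL hU hKN hKH hpin hW hWK hwK hN hwN hρ hr2 hρσ hOform ho hβ hβr)
    (by have := NeZero.pos L; positivity) hlo hhi

end Rows

end M2
end Summit.Ventures.CertifiedManyBodySolver
end
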